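import Literature.Analysis.Complex.UpperHalfPlaneBoundaryContour
import Mathlib.Analysis.SpecialFunctions.Pow.Asymptotics
import Mathlib.Analysis.SpecialFunctions.Pow.Real
import Mathlib.Analysis.Analytic.Basic
import HarnessLib

/-!
# The three-sides integral of a sum of Puiseux branches over the upper half-plane

Topic `Literature/Analysis/Complex` (namespace `Literature.Analysis.Complex.BoundaryContour`),
sequel to `UpperHalfPlaneBoundaryContour.lean`. Everything here is PROVED; no definition and no
named fact is introduced.

Let `Φ` be a function on the upper half-plane which, for `Im u > 0` and `|u| ≥ R₀`, is a finite
signed sum `Φ(u) = Σ_v η_v ỹ_v(u)` of convergent Laurent–Puiseux branches at infinity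
`ỹ_v(u) = (Σ_{i < N_v} a_{v,i} sⁱ + s^{N_v} ρ_v(s)) / s^N`, `s = u^{-1/n}`
(the branch `s(u) = exp(-logU(u)/n)` of `UpperHalfPlaneBoundaryContour.lean`, `ρ_v` analytic
near `0`, `N_v ≥ N + n + 2`) — the shape produced by
`Literature.FieldTheory.AlgClosed.PuiseuxInfinityAlgebraic.exists_algebraicBranches_atInfinity`.
Then the real part of the three-sides integral `T(Φ, R)` over `∂([-R, R] × [0, R]) ∖ (bottom)`
has the divergent asymptotic expansion

  `Re T(Φ, R) = Σ_{i < N+n} c_i R^{(N-i)/n + 1} + π Σ_v η_v Im a_{v,N+n} + o(1)`, `R → ∞`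

(`tendsto_re_threeSides_puiseuxSum`): termwise integration of the monomials `u^{(N-i)/n}`
(`threeSides_cexp_mul_logU_real`, `threeSides_inv` for the residue term `i = N + n`) and the
length estimate for the remainder. Combined with `integral_boundaryValues_eq_threeSides` and the
uniqueness of divergent expansions, this evaluates `∫_ℝ Re Φ(x + i0) dx = π Σ_v η_v Im a_{v,N+n}`
when that integral is eventually constant in `R` — the contour computation at infinity in the
proof of Rokhlin's complex orientation formula
(`Literature/AlgebraicGeometry/RealAlgebraic/ComplexOrientationFormula.lean`). Also recorded:
boundary values obtained by dominated convergence are integrable (`intervalIntegrable_of_boundaryValues`).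
[folklore]

## References

* L. V. Ahlfors, *Complex Analysis*, 3rd ed. (1979), Ch. 4 (Cauchy's theorem; residues). [folklore]
* E. Brieskorn, H. Knörrer, *Plane Algebraic Curves* (1986), §8.3 (branches at infinity). [folklore]
-/

noncomputable section

open Complex MeasureTheory Set Filter intervalIntegral Metric
open scoped Topology Real

namespace Literature.Analysis.Complex

namespace BoundaryContour

/-! ### Points of the three sides -/

/-- Points of the top side lie off the closed negative imaginary axis. [folklore] -/
theorem neg_I_mul_top_mem_slitPlane {R : ℝ} (hR : 0 < R) (x : ℝ) :
    -I * ((x : ℂ) + R * I) ∈ slitPlane :=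
  neg_I_mul_mem_slitPlane (Or.inl (by simp [hR]))

/-- Points of the vertical sides lie off the closed negative imaginary axis. [folklore] -/
theorem neg_I_mul_side_mem_slitPlane {a : ℝ} (ha : a ≠ 0) {y : ℝ} (hy : 0 ≤ y) :
    -I * ((a : ℂ) + y * I) ∈ slitPlane := by
  rcases hy.lt_or_eq with h | h
  · exact neg_I_mul_mem_slitPlane (Or.inl (by simp [h]))
  · exact neg_I_mul_mem_slitPlane (Or.inr ⟨by simp [← h], by simp [ha]⟩)

/-- Points of the top side have modulus `≥ R`. [folklore] -/
theorem le_norm_top {R : ℝ} (hR : 0 ≤ R) (x : ℝ) : R ≤ ‖(x : ℂ) + R * I‖ := by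
  have h := abs_im_le_norm ((x : ℂ) + R * I)
  simp only [add_im, ofReal_im, mul_im, ofReal_re, I_im, mul_one, I_re, mul_zero, add_zero,
    zero_add, abs_of_nonneg hR] at h
  exact h

/-- Points of the vertical side over `a` have modulus `≥ R` as soon as `|a| ≥ R`. [folklore] -/
theorem le_norm_side {R : ℝ} (a y : ℝ) (ha : R ≤ |a|) : R ≤ ‖(a : ℂ) + y * I‖ := by
  have h := abs_re_le_norm ((a : ℂ) + y * I)
  simp only [add_re, ofReal_re, mul_re, I_re, mul_zero, ofReal_im, I_im, mul_one, sub_self,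
    add_zero] at h
  exact ha.trans h

/-- A point off the closed negative imaginary axis is non-zero. [folklore] -/
theorem ne_zero_of_neg_I_mul_mem_slitPlane {u : ℂ} (hu : -I * u ∈ slitPlane) : u ≠ 0 := by
  rintro rfl
  simp at hu

/-- Continuity along the three sides of a function continuous on
`{u | -iu ∈ slitPlane, |u| > R₁}`, `R₁ < R`. [folklore] -/
theorem continuousOn_sides {G : ℂ → ℂ} {R₁ R : ℝ} (hR : R₁ < R) (hR0 : 0 < R)
    (hG : ∀ u : ℂ, -I * u ∈ slitPlane → R₁ < ‖u‖ → ContinuousAt G u) :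
    ContinuousOn (fun x : ℝ => G (x + R * I)) (uIcc (-R) R) ∧
      ContinuousOn (fun y : ℝ => G (R + y * I)) (uIcc 0 R) ∧
      ContinuousOn (fun y : ℝ => G (-R + y * I)) (uIcc 0 R) := by
  refine ⟨?_, ?_, ?_⟩
  · refine continuousOn_of_forall_continuousAt fun x _ => ?_
    exact (hG _ (neg_I_mul_top_mem_slitPlane hR0 x) (hR.trans_le (le_norm_top hR0.le x))).comp
      (f := fun x : ℝ => (x : ℂ) + R * I) (by fun_prop)
  · refine continuousOn_of_forall_continuousAt fun y hy => ?_
    rw [uIcc_of_le hR0.le] at hy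
    exact (hG _ (neg_I_mul_side_mem_slitPlane hR0.ne' hy.1)
      (hR.trans_le (le_norm_side R y (le_abs_self R)))).comp
      (f := fun y : ℝ => (R : ℂ) + y * I) (by fun_prop)
  · refine continuousOn_of_forall_continuousAt fun y hy => ?_
    rw [uIcc_of_le hR0.le] at hy
    have h := (hG _ (neg_I_mul_side_mem_slitPlane (neg_ne_zero.2 hR0.ne') hy.1)
      (hR.trans_le (le_norm_side (-R) y (by rw [abs_neg]; exact le_abs_self R)))).comp
      (f := fun y : ℝ => ((-R : ℝ) : ℂ) + y * I) (x := y) (by fun_prop)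
    simpa [Function.comp_def] using h

/-! ### Linearity and congruence of the three-sides functional -/

/-- The three-sides functional only sees the values at points `u` with `Im u > 0`, `|u| ≥ R`
(`R > 0`; the bottom endpoints of the vertical sides are irrelevant). [folklore] -/
theorem threeSides_congr {f g : ℂ → ℂ} {R : ℝ} (hR : 0 < R)
    (h : ∀ u : ℂ, 0 < u.im → R ≤ ‖u‖ → f u = g u) :
    (∫ x in (-R : ℝ)..R, f (x + R * I)) - I • (∫ y in (0 : ℝ)..R, f (R + y * I)) +
        I • (∫ y in (0 : ℝ)..R, f (-R + y * I)) =
      (∫ x in (-R : ℝ)..R, g (x + R * I)) - I • (∫ y in (0 : ℝ)..R, g (R + y * I)) +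
        I • (∫ y in (0 : ℝ)..R, g (-R + y * I)) := by
  have htop : ∫ x in (-R : ℝ)..R, f (x + R * I) = ∫ x in (-R : ℝ)..R, g (x + R * I) :=
    integral_congr fun x _ => h _ (by simp [hR]) (le_norm_top hR.le x)
  have hside : ∀ a : ℝ, R ≤ |a| →
      ∫ y in (0 : ℝ)..R, f (a + y * I) = ∫ y in (0 : ℝ)..R, g (a + y * I) := by
    intro a ha
    refine integral_congr_ae (Eventually.of_forall fun y hy => ?_)
    rw [uIoc_of_le hR.le] at hy
    exact h _ (by simpa using hy.1) (le_norm_side a y ha)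
  rw [htop, hside R (by rw [abs_of_pos hR])]
  have := hside (-R) (by rw [abs_neg, abs_of_pos hR])
  push_cast at this
  rw [this]

/-- Additivity of the three-sides functional (continuous integrands). [folklore] -/
theorem threeSides_add {f g : ℂ → ℂ} {R₁ R : ℝ} (hR : R₁ < R) (hR0 : 0 < R)
    (hf : ∀ u : ℂ, -I * u ∈ slitPlane → R₁ < ‖u‖ → ContinuousAt f u)
    (hg : ∀ u : ℂ, -I * u ∈ slitPlane → R₁ < ‖u‖ → ContinuousAt g u) :
    (∫ x in (-R : ℝ)..R, (f (x + R * I) + g (x + R * I))) -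
        I • (∫ y in (0 : ℝ)..R, (f (R + y * I) + g (R + y * I))) +
        I • (∫ y in (0 : ℝ)..R, (f (-R + y * I) + g (-R + y * I))) =
      ((∫ x in (-R : ℝ)..R, f (x + R * I)) - I • (∫ y in (0 : ℝ)..R, f (R + y * I)) +
        I • (∫ y in (0 : ℝ)..R, f (-R + y * I))) +
      ((∫ x in (-R : ℝ)..R, g (x + R * I)) - I • (∫ y in (0 : ℝ)..R, g (R + y * I)) +
        I • (∫ y in (0 : ℝ)..R, g (-R + y * I))) := by
  obtain ⟨hf1, hf2, hf3⟩ := continuousOn_sides hR hR0 hf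
  obtain ⟨hg1, hg2, hg3⟩ := continuousOn_sides hR hR0 hg
  rw [integral_add hf1.intervalIntegrable hg1.intervalIntegrable,
    integral_add hf2.intervalIntegrable hg2.intervalIntegrable,
    integral_add hf3.intervalIntegrable hg3.intervalIntegrable]
  simp only [smul_eq_mul]
  ring

/-- Linearity of the three-sides functional over finite linear combinations (continuous
integrands). [folklore] -/
theorem threeSides_finset_sum {κ : Type*} (K : Finset κ) (b : κ → ℂ) (f : κ → ℂ → ℂ) {R₁ R : ℝ}
    (hR : R₁ < R) (hR0 : 0 < R)
    (hf : ∀ k ∈ K, ∀ u : ℂ, -I * u ∈ slitPlane → R₁ < ‖u‖ → ContinuousAt (f k) u) :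
    (∫ x in (-R : ℝ)..R, ∑ k ∈ K, b k * f k (x + R * I)) -
        I • (∫ y in (0 : ℝ)..R, ∑ k ∈ K, b k * f k (R + y * I)) +
        I • (∫ y in (0 : ℝ)..R, ∑ k ∈ K, b k * f k (-R + y * I)) =
      ∑ k ∈ K, b k * ((∫ x in (-R : ℝ)..R, f k (x + R * I)) -
        I • (∫ y in (0 : ℝ)..R, f k (R + y * I)) + I • (∫ y in (0 : ℝ)..R, f k (-R + y * I))) := by
  have hcont : ∀ k ∈ K, ContinuousOn (fun x : ℝ => b k * f k (x + R * I)) (uIcc (-R) R) ∧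
      ContinuousOn (fun y : ℝ => b k * f k (R + y * I)) (uIcc 0 R) ∧
      ContinuousOn (fun y : ℝ => b k * f k (-R + y * I)) (uIcc 0 R) := by
    intro k hk
    obtain ⟨h1, h2, h3⟩ := continuousOn_sides hR hR0 (hf k hk)
    exact ⟨continuousOn_const.mul h1, continuousOn_const.mul h2, continuousOn_const.mul h3⟩
  rw [integral_finsetSum fun k hk => (hcont k hk).1.intervalIntegrable,
    integral_finsetSum fun k hk => (hcont k hk).2.1.intervalIntegrable,
    integral_finsetSum fun k hk => (hcont k hk).2.2.intervalIntegrable]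
  simp only [intervalIntegral.integral_const_mul, smul_eq_mul, Finset.mul_sum, ← Finset.sum_sub_distrib,
    ← Finset.sum_add_distrib]
  refine Finset.sum_congr rfl fun k _ => ?_
  ring

/-! ### The branch `s(u) = u^{-1/n}` and the monomials `u^q` -/

/-- Modulus of the monomials: `‖exp (q · logU u)‖ = ‖u‖^q` for real `q`. [folklore] -/
theorem norm_cexp_ofReal_mul_logU {u : ℂ} (hu : u ≠ 0) (q : ℝ) :
    ‖exp ((q : ℂ) * (log (-I * u) + (π / 2 : ℝ) * I))‖ = ‖u‖ ^ q := by
  rw [norm_exp, re_ofReal_mul, re_logU, Real.rpow_def_of_pos (norm_pos_iff.2 hu), mul_comm]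

/-- Modulus of the branch `s(u) = exp(-logU(u)/n)`: `‖s(u)‖ = ‖u‖^{-1/n}`. [folklore] -/
theorem norm_cexp_neg_logU_div {u : ℂ} (hu : u ≠ 0) (n : ℕ) :
    ‖exp (-(log (-I * u) + (π / 2 : ℝ) * I) / n)‖ = ‖u‖ ^ (-(1 : ℝ) / n) := by
  rw [← norm_cexp_ofReal_mul_logU hu]
  congr 1
  push_cast
  ring

/-- The monomials in `s = u^{-1/n}` are the powers `u^{(N-i)/n}`:
`s^i / s^N = exp (((N - i)/n) · logU u)`. [folklore] -/
theorem cexp_neg_logU_div_pow_div {n : ℕ} (hn : n ≠ 0) (u : ℂ) (N i : ℕ) :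
    exp (-(log (-I * u) + (π / 2 : ℝ) * I) / n) ^ i / exp (-(log (-I * u) + (π / 2 : ℝ) * I) / n) ^ N =
      exp (((((N : ℝ) - i) / n : ℝ) : ℂ) * (log (-I * u) + (π / 2 : ℝ) * I)) := by
  rw [← Complex.exp_nat_mul, ← Complex.exp_nat_mul, ← Complex.exp_sub]
  congr 1
  have hn' : (n : ℂ) ≠ 0 := by exact_mod_cast hn
  push_cast
  field_simp
  ring

/-- The branch `s(u) = exp(-logU(u)/n)` is an `n`-th root of `u⁻¹`. [folklore] -/
theorem cexp_neg_logU_div_pow {u : ℂ} (hu : u ≠ 0) {n : ℕ} (hn : n ≠ 0) :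
    exp (-(log (-I * u) + (π / 2 : ℝ) * I) / n) ^ n = u⁻¹ := by
  have hn' : (n : ℂ) ≠ 0 := by exact_mod_cast hn
  rw [← Complex.exp_nat_mul, show (n : ℂ) * (-(log (-I * u) + (π / 2 : ℝ) * I) / n) =
    -(log (-I * u) + (π / 2 : ℝ) * I) by field_simp, Complex.exp_neg, exp_logU hu]

/-- Smallness of the branch: `‖s(u)‖ ≤ r/2` as soon as `‖u‖ ≥ max 1 ((2/r)^n)`. [folklore] -/
theorem norm_cexp_neg_logU_div_le {u : ℂ} {n : ℕ} (hn : 0 < n) {r : ℝ} (hr : 0 < r)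
    (hu1 : 1 ≤ ‖u‖) (hur : (2 / r) ^ n ≤ ‖u‖) :
    ‖exp (-(log (-I * u) + (π / 2 : ℝ) * I) / n)‖ ≤ r / 2 := by
  have hnpos : (0 : ℝ) < n := by exact_mod_cast hn
  have hu0 : u ≠ 0 := norm_pos_iff.1 (by linarith)
  rw [norm_cexp_neg_logU_div hu0, show -(1 : ℝ) / n = -((n : ℝ)⁻¹) by ring,
    Real.rpow_neg (norm_nonneg u)]
  have h2r : 0 < 2 / r := by positivity
  have hbase : 2 / r ≤ ‖u‖ ^ ((n : ℝ)⁻¹) := by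
    calc 2 / r = ((2 / r) ^ n) ^ ((n : ℝ)⁻¹) := (Real.pow_rpow_inv_natCast h2r.le hn.ne').symm
      _ ≤ ‖u‖ ^ ((n : ℝ)⁻¹) :=
        Real.rpow_le_rpow (pow_nonneg h2r.le n) hur (inv_nonneg.2 hnpos.le)
  calc (‖u‖ ^ ((n : ℝ)⁻¹))⁻¹ ≤ (2 / r)⁻¹ := inv_anti₀ h2r hbase
    _ = r / 2 := by rw [inv_div]

/-- The monomial of exponent `-1` is `u⁻¹`. [folklore] -/
theorem cexp_neg_one_mul_logU {u : ℂ} (hu : u ≠ 0) :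
    exp ((((-1 : ℝ)) : ℂ) * (log (-I * u) + (π / 2 : ℝ) * I)) = u⁻¹ := by
  rw [show (((-1 : ℝ)) : ℂ) * (log (-I * u) + (π / 2 : ℝ) * I) =
      -(log (-I * u) + (π / 2 : ℝ) * I) by push_cast; ring, Complex.exp_neg, exp_logU hu]

/-- Continuity of the monomials off the closed negative imaginary axis. [folklore] -/
theorem continuousAt_cexp_mul_logU {u : ℂ} (hu : -I * u ∈ slitPlane) (q : ℂ) :
    ContinuousAt (fun u : ℂ => exp (q * (log (-I * u) + (π / 2 : ℝ) * I))) u :=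
  ((hasDerivAt_logU hu).continuousAt.const_mul q).cexp

/-- Continuity of the branch `s(u)` off the closed negative imaginary axis. [folklore] -/
theorem continuousAt_cexp_neg_logU_div {u : ℂ} (hu : -I * u ∈ slitPlane) (n : ℕ) :
    ContinuousAt (fun u : ℂ => exp (-(log (-I * u) + (π / 2 : ℝ) * I) / n)) u :=
  ((hasDerivAt_logU hu).continuousAt.neg.div_const _).cexp

/-! ### Real parts of the elementary terms -/

/-- Real part of `η · a · t · κ` for real `η`, `t`. [folklore] -/
theorem re_ofReal_mul_mul_ofReal_mul (η t : ℝ) (a κ : ℂ) :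
    ((η : ℂ) * (a * ((t : ℂ) * κ))).re = η * (t * (a * κ).re) := by
  rw [show (η : ℂ) * (a * ((t : ℂ) * κ)) = ((η * t : ℝ) : ℂ) * (a * κ) by push_cast; ring,
    re_ofReal_mul]
  ring

/-- Real part of the residue term `η · a · (-πi)`: it is `π η Im a`. [folklore] -/
theorem re_ofReal_mul_mul_neg_pi_mul_I (η : ℝ) (a : ℂ) :
    ((η : ℂ) * (a * (-π * I))).re = π * (η * a.im) := by
  simp only [mul_re, ofReal_re, ofReal_im, neg_re, neg_im, mul_im, I_re, I_im,
    mul_zero, mul_one, zero_sub, sub_zero, zero_mul, add_zero, neg_zero]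
  ring


/-! ### Boundary values are integrable -/

/-- Boundary values obtained as a.e. limits of a bounded holomorphic (or just continuous)
function on the upper half-plane are integrable on `[-R, R]` and bounded by the same constant.
[folklore] -/
theorem intervalIntegrable_of_boundaryValues {F : ℂ → ℂ} {g : ℝ → ℂ} {R B : ℝ} (hR : 0 < R)
    (hF : ContinuousOn F {z : ℂ | 0 < z.im})
    (hB : ∀ z : ℂ, |z.re| ≤ R → 0 < z.im → z.im ≤ R → ‖F z‖ ≤ B)
    (hg : ∀ᵐ x : ℝ, x ∈ uIoc (-R) R →
      Tendsto (fun δ : ℝ => F (x + δ * I)) (𝓝[>] 0) (𝓝 (g x))) :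
    IntervalIntegrable g volume (-R) R ∧ ∀ᵐ x : ℝ, x ∈ uIoc (-R) R → ‖g x‖ ≤ B := by
  set δ : ℕ → ℝ := fun k => R / (k + 2) with hδ
  have hδpos : ∀ k, 0 < δ k := fun k => by rw [hδ]; positivity
  have hδle : ∀ k, δ k ≤ R := fun k => by
    rw [hδ]
    exact div_le_self hR.le (by have := k.cast_nonneg (α := ℝ); linarith)
  have hδlim : Tendsto δ atTop (𝓝[>] 0) := by
    refine tendsto_nhdsWithin_iff.2 ⟨?_, Eventually.of_forall fun k => hδpos k⟩
    have h1 : Tendsto (fun k : ℕ => (k : ℝ) + 2) atTop atTop :=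
      tendsto_atTop_add_const_right _ _ tendsto_natCast_atTop_atTop
    have h2 := h1.inv_tendsto_atTop.const_mul R
    rw [mul_zero] at h2
    refine h2.congr fun k => ?_
    rw [hδ]; simp [div_eq_mul_inv]
  have hcontk : ∀ k, Continuous fun x : ℝ => F (x + δ k * I) := by
    intro k
    refine hF.comp_continuous (by fun_prop) fun x => ?_
    simp [hδpos k]
  have hmeas : ∀ k, AEStronglyMeasurable (fun x : ℝ => F (x + δ k * I))
      (volume.restrict (uIoc (-R) R)) := fun k => (hcontk k).aestronglyMeasurable
  have hlim : ∀ᵐ x : ℝ ∂(volume.restrict (uIoc (-R) R)),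
      Tendsto (fun k => F ((x : ℂ) + δ k * I)) atTop (𝓝 (g x)) := by
    rw [ae_restrict_iff' measurableSet_uIoc]
    filter_upwards [hg] with x hx hxm
    exact (hx hxm).comp hδlim
  have hgm : AEStronglyMeasurable g (volume.restrict (uIoc (-R) R)) :=
    aestronglyMeasurable_of_tendsto_ae atTop hmeas hlim
  have hgb : ∀ᵐ x : ℝ ∂(volume.restrict (uIoc (-R) R)), ‖g x‖ ≤ B := by
    rw [ae_restrict_iff' measurableSet_uIoc] at hlim ⊢
    filter_upwards [hlim] with x hx hxm
    refine le_of_tendsto' ((hx hxm).norm) fun k => hB _ ?_ (by simp [hδpos k]) (by simp [hδle k])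
    rw [uIoc_of_le (by linarith)] at hxm
    simp only [add_re, ofReal_re, mul_re, I_re, mul_zero, ofReal_im, I_im, mul_one, sub_self,
      add_zero]
    exact abs_le.2 ⟨hxm.1.le, hxm.2⟩
  refine ⟨?_, (ae_restrict_iff' measurableSet_uIoc).1 hgb⟩
  rw [intervalIntegrable_iff]
  refine ⟨hgm, HasFiniteIntegral.restrict_of_bounded B ?_ hgb⟩
  rw [uIoc_of_le (by linarith), Real.volume_Ioc]
  exact ENNReal.ofReal_lt_top

/-! ### The expansion of the three-sides integral -/

/-- Re-parts of the elementary terms: `Re(a · t · κ) = t · Re(a κ)` for real `t`. [folklore] -/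
theorem re_mul_ofReal_mul (t : ℝ) (a κ : ℂ) : (a * ((t : ℂ) * κ)).re = t * (a * κ).re := by
  rw [show a * ((t : ℂ) * κ) = (t : ℂ) * (a * κ) by ring, re_ofReal_mul]

/-- Re-part of the residue term: `Re(a · (-πi)) = π Im a`. [folklore] -/
theorem re_mul_neg_pi_mul_I (a : ℂ) : (a * (-π * I)).re = π * a.im := by
  have : a * (-π * I) = -(π : ℂ) * (a * I) := by ring
  rw [this, show (-(π : ℂ)) = ((-π : ℝ) : ℂ) by push_cast; ring, re_ofReal_mul, mul_I_re]
  ring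

/-- Antitonicity of `x ↦ x^q` in the base for `q ≤ 0` (positive bases). [folklore] -/
theorem rpow_le_rpow_of_nonpos_exponent {x y q : ℝ} (hx : 0 < x) (hxy : x ≤ y) (hq : q ≤ 0) :
    y ^ q ≤ x ^ q := by
  have hy : 0 < y := hx.trans_le hxy
  rw [← neg_neg q, Real.rpow_neg hy.le, Real.rpow_neg hx.le]
  exact inv_anti₀ (Real.rpow_pos_of_pos hx _) (Real.rpow_le_rpow hx.le hxy (by linarith))

/-- **Divergent expansion of the three-sides integral of a signed sum of Puiseux branches at
infinity.** Let `Φ(u) = Σ_{v ∈ S} η_v ỹ_v(u)` for `Im u > 0`, `|u| ≥ R₀`, with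
`ỹ_v(u) = (Σ_{i<N_v} a_{v,i} s(u)ⁱ + s(u)^{N_v} ρ_v(s(u))) / s(u)^N`, `s(u) = exp(-logU(u)/n)`
(`n ≥ 1`, `N_v ≥ N + n + 2`, `ρ_v` analytic on `|s| < r`). Then for suitable real `c_i`,
`Re T(Φ, R) - Σ_{i<N+n} c_i R^{(N-i)/n+1} - π Σ_v η_v Im a_{v,N+n} → 0` as `R → ∞`, where
`T(Φ, R) = ∫_{-R}^{R} Φ(x+iR) dx - i∫_0^R Φ(R+iy) dy + i∫_0^R Φ(-R+iy) dy`. [folklore] -/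
theorem tendsto_re_threeSides_puiseuxSum {ι : Type*} (S : Finset ι) (η : ι → ℝ) (a : ι → ℕ → ℂ)
    (Nv : ι → ℕ) (ρ : ι → ℂ → ℂ) {n N : ℕ} (hn : 0 < n) {r : ℝ} (R₀ : ℝ) (hr : 0 < r)
    (hNv : ∀ v ∈ S, N + n + 2 ≤ Nv v)
    (hρ : ∀ v ∈ S, ∀ s ∈ ball (0 : ℂ) r, AnalyticAt ℂ (ρ v) s)
    (Φ : ℂ → ℂ)
    (hΦ : ∀ u : ℂ, 0 < u.im → R₀ ≤ ‖u‖ →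
      Φ u = ∑ v ∈ S, (η v : ℂ) *
        ((∑ i ∈ Finset.range (Nv v), a v i * exp (-(log (-I * u) + (π / 2 : ℝ) * I) / n) ^ i +
            exp (-(log (-I * u) + (π / 2 : ℝ) * I) / n) ^ (Nv v) * ρ v (exp (-(log (-I * u) + (π / 2 : ℝ) * I) / n))) /
          exp (-(log (-I * u) + (π / 2 : ℝ) * I) / n) ^ N)) :
    ∃ c : ℕ → ℝ, Tendsto (fun R : ℝ =>
      ((∫ x in (-R : ℝ)..R, Φ (x + R * I)) - I • (∫ y in (0 : ℝ)..R, Φ (R + y * I)) +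
            I • (∫ y in (0 : ℝ)..R, Φ (-R + y * I))).re -
        ∑ i ∈ Finset.range (N + n), R ^ (((N : ℝ) - i) / n + 1) * c i -
        π * ∑ v ∈ S, η v * (a v (N + n)).im) atTop (𝓝 0) := by
  classical
  -- ### the players, as opaque functions with defining equations
  obtain ⟨p, hp⟩ : ∃ p : ℕ → ℝ, ∀ i, p i = ((N : ℝ) - i) / n := ⟨_, fun _ => rfl⟩
  obtain ⟨sf, hsf⟩ : ∃ sf : ℂ → ℂ, ∀ u, sf u = exp (-(log (-I * u) + (π / 2 : ℝ) * I) / n) := ⟨_, fun _ => rfl⟩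
  obtain ⟨pw, hpw⟩ : ∃ pw : ℕ → ℂ → ℂ, ∀ i u, pw i u = exp ((p i : ℂ) * (log (-I * u) + (π / 2 : ℝ) * I)) :=
    ⟨_, fun _ _ => rfl⟩
  obtain ⟨rem, hrem⟩ : ∃ rem : ι → ℂ → ℂ, ∀ v u, rem v u = pw (Nv v) u * ρ v (sf u) :=
    ⟨_, fun _ _ => rfl⟩
  obtain ⟨mn, hmn⟩ : ∃ mn : ι → ℂ → ℂ, ∀ v u,
      mn v u = ∑ i ∈ Finset.range (Nv v), a v i * pw i u := ⟨_, fun _ _ => rfl⟩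
  obtain ⟨gv, hgv⟩ : ∃ gv : ι → ℂ → ℂ, ∀ v u, gv v u = mn v u + rem v u := ⟨_, fun _ _ => rfl⟩
  obtain ⟨κ, hκ⟩ : ∃ κ : ℕ → ℂ, ∀ i,
      κ i = (1 - exp (((p i : ℂ) + 1) * (π * I))) / ((p i : ℂ) + 1) := ⟨_, fun _ => rfl⟩
  obtain ⟨c, hc⟩ : ∃ c : ℕ → ℝ, ∀ i, c i = ∑ v ∈ S, η v * (a v i * κ i).re := ⟨_, fun _ => rfl⟩
  refine ⟨c, ?_⟩
  have hn0 : (n : ℝ) ≠ 0 := by exact_mod_cast hn.ne'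
  have hnpos : (0 : ℝ) < n := by exact_mod_cast hn
  -- ### exponents
  have hp1 : ∀ i, p i + 1 = ((N : ℝ) + n - i) / n := fun i => by
    rw [hp]; field_simp; ring
  have hpne : ∀ i, i ≠ N + n → p i + 1 ≠ 0 := by
    intro i hi h
    rw [hp1, div_eq_zero_iff, or_iff_left hn0, sub_eq_zero] at h
    exact hi (by exact_mod_cast h.symm)
  have hpres : p (N + n) = -1 := by
    rw [hp]; push_cast; field_simp; ring
  have hpneg : ∀ i, N + n < i → p i + 1 < 0 := by
    intro i hi
    rw [hp1]
    refine div_neg_of_neg_of_pos ?_ hnpos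
    have : ((N + n : ℕ) : ℝ) < i := by exact_mod_cast hi
    push_cast at this
    linarith
  have hpNv : ∀ v ∈ S, p (Nv v) + 1 ≤ -((2 : ℝ) / n) := by
    intro v hv
    rw [hp1, show -((2 : ℝ) / n) = (-2) / n by ring, div_le_div_iff_of_pos_right hnpos]
    have : ((N + n + 2 : ℕ) : ℝ) ≤ Nv v := by exact_mod_cast hNv v hv
    push_cast at this
    linarith
  have h2n : 0 < (2 : ℝ) / n := by positivity
  -- ### a bound for the analytic remainders on `|s| ≤ r/2`
  have hbound : ∃ M : ℝ, 0 ≤ M ∧ ∀ v ∈ S, ∀ s : ℂ, ‖s‖ ≤ r / 2 → ‖ρ v s‖ ≤ M := by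
    have hv : ∀ v, ∃ M, v ∈ S → ∀ s : ℂ, ‖s‖ ≤ r / 2 → ‖ρ v s‖ ≤ M := by
      intro v
      by_cases hv : v ∈ S
      · have hcont : ContinuousOn (ρ v) (closedBall (0 : ℂ) (r / 2)) := fun s hs =>
          (hρ v hv s (closedBall_subset_ball (by linarith) hs)).continuousAt.continuousWithinAt
        obtain ⟨M, hM⟩ := (isCompact_closedBall (0 : ℂ) (r / 2)).exists_bound_of_continuousOn hcont
        exact ⟨M, fun _ s hs => hM s (mem_closedBall_zero_iff.2 hs)⟩
      · exact ⟨0, fun h => absurd h hv⟩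
    choose Mv hMv using hv
    refine ⟨∑ v ∈ S, |Mv v|, Finset.sum_nonneg fun v _ => abs_nonneg _, fun v hv s hs => ?_⟩
    exact ((hMv v hv s hs).trans (le_abs_self _)).trans
      (Finset.single_le_sum (f := fun v => |Mv v|) (fun v _ => abs_nonneg _) hv)
  obtain ⟨M, hM0, hM⟩ := hbound
  -- ### the threshold
  set R₁ : ℝ := max (max R₀ 1) ((2 / r) ^ n) with hR₁
  have hR₁1 : 1 ≤ R₁ := (le_max_right _ _).trans (le_max_left _ _)
  have hR₁0 : R₀ ≤ R₁ := (le_max_left _ _).trans (le_max_left _ _)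
  have hR₁r : (2 / r) ^ n ≤ R₁ := le_max_right _ _
  have hsf_small : ∀ u : ℂ, R₁ ≤ ‖u‖ → ‖sf u‖ ≤ r / 2 := by
    intro u hu
    rw [hsf]
    exact norm_cexp_neg_logU_div_le hn hr (hR₁1.trans hu) (hR₁r.trans hu)
  have hsf_mem : ∀ u : ℂ, R₁ ≤ ‖u‖ → sf u ∈ ball (0 : ℂ) r := fun u hu => by
    rw [mem_ball_zero_iff]
    exact (hsf_small u hu).trans_lt (by linarith)
  -- ### continuity off the closed negative imaginary axis, beyond `R₁`
  have hpw_cont : ∀ i (u : ℂ), -I * u ∈ slitPlane → R₁ < ‖u‖ → ContinuousAt (pw i) u := by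
    intro i u hu _
    have : pw i = fun u => exp ((p i : ℂ) * (log (-I * u) + (π / 2 : ℝ) * I)) := funext fun u => hpw i u
    rw [this]
    exact continuousAt_cexp_mul_logU hu _
  have hsf_cont : ∀ u : ℂ, -I * u ∈ slitPlane → ContinuousAt sf u := by
    intro u hu
    have : sf = fun u => exp (-(log (-I * u) + (π / 2 : ℝ) * I) / n) := funext fun u => hsf u
    rw [this]
    exact continuousAt_cexp_neg_logU_div hu n
  have hrem_cont : ∀ v ∈ S, ∀ u : ℂ, -I * u ∈ slitPlane → R₁ < ‖u‖ → ContinuousAt (rem v) u := by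
    intro v hv u hu hRu
    have : rem v = fun u => pw (Nv v) u * ρ v (sf u) := funext fun u => hrem v u
    rw [this]
    refine (hpw_cont _ u hu hRu).mul ?_
    exact ContinuousAt.comp (g := ρ v) (hρ v hv _ (hsf_mem u hRu.le)).continuousAt (hsf_cont u hu)
  have hmn_cont : ∀ v ∈ S, ∀ u : ℂ, -I * u ∈ slitPlane → R₁ < ‖u‖ → ContinuousAt (mn v) u := by
    intro v _ u hu hRu
    have : mn v = fun u => ∑ i ∈ Finset.range (Nv v), a v i * pw i u := funext fun u => hmn v u
    rw [this]
    exact tendsto_finsetSum _ fun i _ => ((hpw_cont i u hu hRu).const_mul (a v i))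
  have hgv_cont : ∀ v ∈ S, ∀ u : ℂ, -I * u ∈ slitPlane → R₁ < ‖u‖ → ContinuousAt (gv v) u := by
    intro v hv u hu hRu
    have : gv v = fun u => mn v u + rem v u := funext fun u => hgv v u
    rw [this]
    exact (hmn_cont v hv u hu hRu).add (hrem_cont v hv u hu hRu)
  -- ### pointwise: `Φ = Σ_v η_v gv_v` for `Im u > 0`, `|u| ≥ R₁`
  have hdecomp : ∀ v ∈ S, ∀ u : ℂ,
      (∑ i ∈ Finset.range (Nv v), a v i * exp (-(log (-I * u) + (π / 2 : ℝ) * I) / n) ^ i +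
          exp (-(log (-I * u) + (π / 2 : ℝ) * I) / n) ^ (Nv v) * ρ v (exp (-(log (-I * u) + (π / 2 : ℝ) * I) / n))) / exp (-(log (-I * u) + (π / 2 : ℝ) * I) / n) ^ N =
        gv v u := by
    intro v _ u
    rw [hgv, hmn, hrem]
    simp only [hpw, hp, hsf]
    rw [add_div, Finset.sum_div]
    congr 1
    · refine Finset.sum_congr rfl fun i _ => ?_
      rw [mul_div_assoc, cexp_neg_logU_div_pow_div hn.ne' u N i]
    · rw [mul_div_right_comm, cexp_neg_logU_div_pow_div hn.ne' u N (Nv v)]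
  have hΦgv : ∀ R : ℝ, R₁ ≤ R → ∀ u : ℂ, 0 < u.im → R ≤ ‖u‖ →
      Φ u = ∑ v ∈ S, (η v : ℂ) * gv v u := by
    intro R hR u hu hRu
    rw [hΦ u hu (hR₁0.trans (hR.trans hRu))]
    exact Finset.sum_congr rfl fun v hv => by rw [hdecomp v hv u]
  -- ### the three-sides functional, termwise
  have key : ∀ R : ℝ, R₁ < R →
      ((∫ x in (-R : ℝ)..R, Φ (x + R * I)) - I • (∫ y in (0 : ℝ)..R, Φ (R + y * I)) +
            I • (∫ y in (0 : ℝ)..R, Φ (-R + y * I))) =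
        ∑ v ∈ S, (η v : ℂ) * (∑ i ∈ Finset.range (Nv v), a v i *
          ((∫ x in (-R : ℝ)..R, (pw i) (x + R * I)) - I • (∫ y in (0 : ℝ)..R, (pw i) (R + y * I)) +
            I • (∫ y in (0 : ℝ)..R, (pw i) (-R + y * I))) +
          ((∫ x in (-R : ℝ)..R, (rem v) (x + R * I)) - I • (∫ y in (0 : ℝ)..R, (rem v) (R + y * I)) +
            I • (∫ y in (0 : ℝ)..R, (rem v) (-R + y * I)))) := by
    intro R hR
    have hR0 : 0 < R := by linarith
    rw [threeSides_congr hR0 (hΦgv R hR.le),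
      threeSides_finset_sum S (fun v => (η v : ℂ)) gv hR hR0 hgv_cont]
    refine Finset.sum_congr rfl fun v hv => ?_
    congr 1
    simp only [hgv]
    rw [threeSides_add hR hR0 (hmn_cont v hv) (hrem_cont v hv)]
    congr 1
    simp only [hmn]
    exact threeSides_finset_sum (Finset.range (Nv v)) (a v) pw hR hR0 fun i _ => hpw_cont i
  -- ### the monomial integrals
  have hpw_val : ∀ i, i ≠ N + n → ∀ R : ℝ, 0 < R →
      ((∫ x in (-R : ℝ)..R, (pw i) (x + R * I)) - I • (∫ y in (0 : ℝ)..R, (pw i) (R + y * I)) +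
            I • (∫ y in (0 : ℝ)..R, (pw i) (-R + y * I))) = ((R ^ (p i + 1) : ℝ) : ℂ) * κ i := by
    intro i hi R hR
    simp only [hpw]
    rw [threeSides_cexp_mul_logU_real hR (hpne i hi), hκ]
  have hpw_res : ∀ R : ℝ, 0 < R →
      ((∫ x in (-R : ℝ)..R, (pw (N + n)) (x + R * I)) - I • (∫ y in (0 : ℝ)..R, (pw (N + n)) (R + y * I)) +
            I • (∫ y in (0 : ℝ)..R, (pw (N + n)) (-R + y * I))) = -π * I := by
    intro R hR
    rw [← threeSides_inv hR]
    refine threeSides_congr hR fun u hu hRu => ?_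
    rw [hpw, hpres, cexp_neg_one_mul_logU (norm_pos_iff.1 (hR.trans_le hRu))]
  -- ### the remainder estimate
  have hrem_bound : ∀ v ∈ S, ∀ R : ℝ, R₁ < R →
      ‖((∫ x in (-R : ℝ)..R, (rem v) (x + R * I)) - I • (∫ y in (0 : ℝ)..R, (rem v) (R + y * I)) +
            I • (∫ y in (0 : ℝ)..R, (rem v) (-R + y * I)))‖ ≤ 4 * M * R ^ (-((2 : ℝ) / n)) := by
    intro v hv R hR
    have hR0 : 0 < R := by linarith
    have hR1 : 1 ≤ R := hR₁1.trans hR.le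
    have hp0 : p (Nv v) ≤ 0 := by linarith [hpNv v hv, h2n.le]
    have hptw : ∀ u : ℂ, R ≤ ‖u‖ → ‖rem v u‖ ≤ R ^ (p (Nv v)) * M := by
      intro u hu
      have hu0 : u ≠ 0 := norm_pos_iff.1 (hR0.trans_le hu)
      rw [hrem, norm_mul, hpw, norm_cexp_ofReal_mul_logU hu0]
      exact mul_le_mul (rpow_le_rpow_of_nonpos_exponent hR0 hu hp0)
        (hM v hv _ (hsf_small u (hR.le.trans hu))) (norm_nonneg _) (Real.rpow_nonneg hR0.le _)
    have h := norm_threeSides_le (φ := rem v) (C := R ^ (p (Nv v)) * M) hR0.le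
      (fun x _ => hptw _ (le_norm_top hR0.le x))
      (fun y _ => hptw _ (le_norm_side R y (le_abs_self R)))
      (fun y _ => hptw _ (by
        have h := le_norm_side (R := R) (-R) y (by rw [abs_neg]; exact le_abs_self R)
        simpa using h))
    refine h.trans ?_
    calc 4 * R * (R ^ p (Nv v) * M) = 4 * M * R ^ (p (Nv v) + 1) := by
          rw [Real.rpow_add hR0, Real.rpow_one]; ring
      _ ≤ 4 * M * R ^ (-((2 : ℝ) / n)) :=
          mul_le_mul_of_nonneg_left (Real.rpow_le_rpow_of_exponent_le hR1 (hpNv v hv))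
            (by positivity)
  -- ### the two tails tend to zero
  have htail_rem : Tendsto (fun R : ℝ => ∑ v ∈ S, η v *
      ((∫ x in (-R : ℝ)..R, (rem v) (x + R * I)) - I • (∫ y in (0 : ℝ)..R, (rem v) (R + y * I)) +
            I • (∫ y in (0 : ℝ)..R, (rem v) (-R + y * I))).re) atTop (𝓝 0) := by
    have hlim : Tendsto (fun R : ℝ => 4 * M * R ^ (-((2 : ℝ) / n))) atTop (𝓝 0) := by
      have := (tendsto_rpow_neg_atTop h2n).const_mul (4 * M)
      rwa [mul_zero] at this
    have key : ∀ v ∈ S, Tendsto (fun R : ℝ =>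
        ((∫ x in (-R : ℝ)..R, (rem v) (x + R * I)) - I • (∫ y in (0 : ℝ)..R, (rem v) (R + y * I)) +
            I • (∫ y in (0 : ℝ)..R, (rem v) (-R + y * I))).re) atTop (𝓝 0) := by
      intro v hv
      refine squeeze_zero_norm' ?_ hlim
      filter_upwards [eventually_gt_atTop R₁] with R hR
      rw [Real.norm_eq_abs]
      exact (abs_re_le_norm _).trans (hrem_bound v hv R hR)
    have h := tendsto_finsetSum S fun v hv => (key v hv).const_mul (η v)
    simp only [mul_zero, Finset.sum_const_zero] at h
    exact h
  have htail_main : Tendsto (fun R : ℝ => ∑ v ∈ S, η v *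
      ∑ i ∈ Finset.Ico (N + n + 1) (Nv v), R ^ (p i + 1) * (a v i * κ i).re) atTop (𝓝 0) := by
    have h0 : (0 : ℝ) = ∑ v ∈ S, η v * ∑ i ∈ Finset.Ico (N + n + 1) (Nv v),
        (0 : ℝ) * (a v i * κ i).re := by simp
    rw [h0]
    refine tendsto_finsetSum _ fun v _ => Tendsto.const_mul _ ?_
    refine tendsto_finsetSum _ fun i hi => Tendsto.mul_const _ ?_
    have hi' : N + n < i := by have := (Finset.mem_Ico.1 hi).1; omega
    have := tendsto_rpow_neg_atTop (y := -(p i + 1)) (by linarith [hpneg i hi'])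
    simpa using this
  have htail := htail_main.add htail_rem
  rw [add_zero] at htail
  -- ### conclusion: eventually the quantity in question is the sum of the two tails
  refine htail.congr' ?_
  filter_upwards [eventually_gt_atTop R₁] with R hR
  have hR0 : 0 < R := by linarith
  symm
  rw [key R hR, Complex.re_sum]
  have hvR : ∀ v ∈ S, ((η v : ℂ) * (∑ i ∈ Finset.range (Nv v), a v i *
          ((∫ x in (-R : ℝ)..R, (pw i) (x + R * I)) - I • (∫ y in (0 : ℝ)..R, (pw i) (R + y * I)) +
            I • (∫ y in (0 : ℝ)..R, (pw i) (-R + y * I))) +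
          ((∫ x in (-R : ℝ)..R, (rem v) (x + R * I)) - I • (∫ y in (0 : ℝ)..R, (rem v) (R + y * I)) +
            I • (∫ y in (0 : ℝ)..R, (rem v) (-R + y * I))))).re =
        η v * (∑ i ∈ Finset.range (N + n), R ^ (p i + 1) * (a v i * κ i).re) +
          η v * (π * (a v (N + n)).im) +
          η v * (∑ i ∈ Finset.Ico (N + n + 1) (Nv v), R ^ (p i + 1) * (a v i * κ i).re) +
          η v * ((∫ x in (-R : ℝ)..R, (rem v) (x + R * I)) - I • (∫ y in (0 : ℝ)..R, (rem v) (R + y * I)) +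
            I • (∫ y in (0 : ℝ)..R, (rem v) (-R + y * I))).re := by
    intro v hv
    rw [re_ofReal_mul, add_re, Complex.re_sum]
    have hle : N + n + 1 ≤ Nv v := by have := hNv v hv; omega
    have hsplit : ∑ i ∈ Finset.range (Nv v), (a v i *
          ((∫ x in (-R : ℝ)..R, (pw i) (x + R * I)) - I • (∫ y in (0 : ℝ)..R, (pw i) (R + y * I)) +
            I • (∫ y in (0 : ℝ)..R, (pw i) (-R + y * I)))).re =
        (∑ i ∈ Finset.range (N + n), R ^ (p i + 1) * (a v i * κ i).re + π * (a v (N + n)).im) +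
          ∑ i ∈ Finset.Ico (N + n + 1) (Nv v), R ^ (p i + 1) * (a v i * κ i).re := by
      rw [Finset.range_eq_Ico, ← Finset.sum_Ico_consecutive _ (Nat.zero_le (N + n + 1)) hle,
        Finset.sum_Ico_succ_top (Nat.zero_le _), Finset.range_eq_Ico]
      congr 1
      · congr 1
        · refine Finset.sum_congr rfl fun i hi => ?_
          have hi' : i ≠ N + n := by have := (Finset.mem_Ico.1 hi).2; omega
          rw [hpw_val i hi' R hR0, re_mul_ofReal_mul]
        · rw [hpw_res R hR0, re_mul_neg_pi_mul_I]
      · refine Finset.sum_congr rfl fun i hi => ?_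
        have hi' : i ≠ N + n := by have := (Finset.mem_Ico.1 hi).1; omega
        rw [hpw_val i hi' R hR0, re_mul_ofReal_mul]
    rw [hsplit]
    ring
  rw [Finset.sum_congr rfl hvR]
  simp only [Finset.sum_add_distrib]
  have hswap : ∑ v ∈ S, η v * ∑ i ∈ Finset.range (N + n), R ^ (p i + 1) * (a v i * κ i).re =
      ∑ i ∈ Finset.range (N + n), R ^ (((N : ℝ) - i) / n + 1) * c i := by
    simp only [Finset.mul_sum]
    rw [Finset.sum_comm]
    refine Finset.sum_congr rfl fun i _ => ?_
    rw [hc, Finset.mul_sum]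
    refine Finset.sum_congr rfl fun v _ => ?_
    rw [hp]
    ring
  have hres : ∑ v ∈ S, η v * (π * (a v (N + n)).im) = π * ∑ v ∈ S, η v * (a v (N + n)).im := by
    rw [Finset.mul_sum]
    exact Finset.sum_congr rfl fun v _ => by ring
  rw [hswap, hres]
  ring

end BoundaryContour

end Literature.Analysis.Complex
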